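import Summits.BirchSwinnertonDyer.BirchSwinnertonDyer.Theorems.SignedLowerHalvesSharpFlatResiduePPartTwistCertificate
import Summits.BirchSwinnertonDyer.Rank1Residual.Partition.MainConjecturesTamagawaJetchev
import Summits.BirchSwinnertonDyer.Rank1Residual.X11b.BDPRouteManin
import Literature.NumberTheory.DiophantineGeometry.AbcWave0GranvilleStarkTheorem2Proofs
import HarnessLib

/-!
# Leaf X8 (`p = 3`, `a₃ = ±3`), analytic rank ONE, TWIST-CERTIFICATE road — the Tamagawa proviso relaxed:
# JETCHEV 2008 (Compos. Math. 144, Thm. 1.1) in place of Kolyvagin's index bound, for the cells with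
# `3 ∣ c_q(E)` at ONE bad prime (cell `bsd-print-x8`, prover seat p4 «TWC road»; companion of
# `Theorems/SignedLowerHalvesSharpFlatResiduePPartTwistCertificate.lean`; `--supports` item
# stmt-BirchSwinnertonDyer-19004; theorems only; closes nothing)

HONEST FRAMING (cell bsd-print-x8): PARTITION currency; this file does NOT prove the leaf `WAllCornerX8`.
The companion file's door `X8.bsdp_rankOne_of_acLowerLink_of_twistCertificate` carries `htam0 : 3 ∤ ∏_ℓ c_ℓ(E)`
because Kolyvagin's bound `ord₃ #Ш(E/K) ≤ 2·ord₃[E(K):ℤP]` is blind to the Tamagawa term of BSD over `K`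
(in the bsd-ssimc census `A8_x8_open_cells.v3.tsv`, 54 of the 75 open rank-one X8 cells have `3 ∣ ∏c`). At a
GOOD prime Jetchev's global divisibility of Heegner points sharpens the bound by the largest Tamagawa
`3`-part: Jetchev, *Global divisibility of Heegner points and Tamagawa numbers*, Compos. Math. 144 (2008)
811–826, Thm. 1.1 (= arXiv Thm. 1.4 + Cor. 1.5): under Hypothesis (∗) «`p ∤ 2N` and `ρ_{E,p}` surjective»,
«`#Ш(E/K)[p^∞] ≤ p^{2m₀−2m_max}`, `m_max = max_{q∣N} ord_p(c_q)`. If `p` divides at most one Tamagawa number,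
our upper bound coincides with the exact upper bound predicted by the Birch and Swinnerton-Dyer conjectural
formula» — the tree's named fact `Jetchev2008.cor15_padicValNat_card_primaryComponent_sha_le` (monotone form at
every `q ∣ N`; optimal parametrisation `hopt`; `d_K ≠ −3`). On X8, `3 ∤ N` holds (good reduction). So on the
cells where the `3`-divisibility of the Tamagawa numbers sits at ONE bad prime `q` (`ord₃ ∏c ≤ ord₃ c_q`), the
same road closes `BSD(E,3)` modulo the SAME one displayed link `hLA` (the anticyclotomic Eisenstein
divisibility at `(3, ±3)` — NOT in print, see the companion's module docstring) and the same numerical twist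
certificate; «beyond-print theorem: NO». NOT reached (said plainly): `3 ∣ c_ℓ(E)` at TWO OR MORE bad primes
(Jetchev–Skinner–Wan 2017 §7.4.2's `K″`/`X_{N⁺,N⁻}` argument; no tree currency); non-optimal `E` except
through Cassels' isogeny invariance on the optimal curve of the class (GLUE seat gen 8,
`Partition/MainConjecturesTamagawaJetchevOptimal.lean`; per pair the certificate is READ on Cremona's
`X₀(N)`-optimal curve).

Contents: `X8.bsdp_rankOne_of_acLowerLinks_of_twistCertificate_field` (the companion's door with the
parametrisation / Heegner data DISCHARGED by the tree's existence theorems: per pair only the field, the twist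
model and the certificate remain; the link demanded at every datum); `printShape_rankZero_of_zone_of_wuthrich` (the twist's rank-zero `3`-part in the EQUALITY shape
from the unit zone + Wuthrich Prop. 21 — bookkeeping); `X8.bsdp_rankOne_of_acLowerLink_of_twistCertificate_of_jetchev`
(datum level: STEP L from `hLA` + JSW 3.3.1 BY NAME, Jetchev's STEP U ⇒ the Heegner-index IDENTITY over `K`
(GLUE seat gen 7 `X11b.indexIdentityAt_of_lowerBound_of_jetchev`), multr1's descent `X11b.bsdp_of_indexIdentityAt`).

References: [Jetchev2008] Hypothesis (∗), Thm. 1.4, Cor. 1.5 (arXiv p. 3) = printed Thm. 1.1 (p. 812);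
[JetchevSkinnerWan2017] Thm. 3.3.1, §7.4.1–§7.4.2; [Wuthrich2014] Prop. 21; [GrossZagier1986] V.§2;
[KolyvaginEulerSystems1990] Thm. A; [Miller2011LMS] Def. 1.1; GLUE.md GEN 7/8 addenda (b2b-bsdres).
-/

set_option autoImplicit false
set_option linter.dupNamespace false

noncomputable section

open scoped Classical NumberField

open WeierstrassCurve NumberField IsDedekindDomain Literature.NumberTheory.EllipticCurves
  Literature.NumberTheory.EllipticCurves.ModularForms
  Literature.NumberTheory.EllipticCurves.Rank1Residual
  Literature.NumberTheory.EllipticCurves.Rank1Residual.Typed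
  Literature.NumberTheory.EllipticCurves.KrizLi2019
  Summit.BirchSwinnertonDyer.Rank1Residual

namespace Summit.BirchSwinnertonDyer.BirchSwinnertonDyer.Theorems.X8TwistCertificate

/-! ### Jetchev's bound in place of Kolyvagin's (cells with `3 ∣ c_q` at ONE bad prime) -/

/-- **The twist's rank-zero `p`-part in the EQUALITY (print) shape from the unit zone and Wuthrich.** For a
rank-zero curve `Wd` GOOD at `p` with `ρ̄_{Wd,p}` onto, the zone `ord_p(L/Ω) + 2·ord_p #tors ≤ ord_p ∏c`
(`hzone`) and Wuthrich 2014 Prop. 21 (`hW`: `ord_p #Ш ≤ ord_p #Ш_an`) force `ord_p #Ш(Wd) = 0` and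
`ord_p(L(Wd,1)/Ω) = ord_p #Ш(Wd) + ord_p ∏c(Wd) − 2·ord_p #Wd(ℚ)_tors` — the `htw` binder of multr1's descent
`X11b.bsdp_of_indexIdentityAt` (bsd.S30 / Skinner 2016 Thm. C shape). Bookkeeping.
[cite: Wuthrich2014, Prop. 21 (p. 400)] [cite: Miller2011LMS, §1 and Def. 1.1] -/
theorem printShape_rankZero_of_zone_of_wuthrich (hW : Wuthrich2014.sha_dvd_analyticSha)
    (hGZK : rank_eq_analyticRank_of_analyticRank_le_one) (hmod : hasEntireLFunction_rat)
    (hmodP : nonempty_modularParametrizationData)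
    (Wd : WeierstrassCurve ℚ) [Wd.IsElliptic] [Wd.IsGloballyMinimal] (p : ℕ) [Fact p.Prime] (hp2 : p ≠ 2)
    (hL : Wd.entireLFunction 1 ≠ 0) (hgood : Wd.HasGoodReductionAtPrime p)
    (hsurj : Wd.HasSurjectiveModNGaloisRep p)
    (hzone : ∃ q : ℚ, Wd.entireLFunction 1 / (Wd.realPeriodRat : ℂ) = (q : ℂ) ∧
      padicValRat p q + 2 * padicValNat p Wd.torsionOrder ≤ padicValNat p Wd.tamagawaProduct) :
    ∃ q : ℚ, Wd.entireLFunction 1 / (Wd.realPeriodRat : ℂ) = (q : ℂ) ∧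
      padicValRat p q = (padicValNat p Wd.shaOrder : ℤ) + padicValNat p Wd.tamagawaProduct -
        2 * padicValNat p Wd.torsionOrder := by
  obtain ⟨q, hq, hle⟩ := leHalf_rankZero_of_wuthrich hW hGZK hmod hmodP Wd p hp2 hL hgood hsurj
  obtain ⟨q', hq', hzone'⟩ := hzone
  have hqq : q' = q := by exact_mod_cast hq'.symm.trans hq
  subst hqq
  refine ⟨q', hq, ?_⟩
  have h0 : (0 : ℤ) ≤ padicValNat p Wd.shaOrder := by positivity
  omega

/-- **`BSD(E,3)` at a RANK-ONE X8 pair on the twist-certificate road with JETCHEV's Tamagawa-sharpened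
bound** — §2 with Kolyvagin's index bound `hB` and the proviso `3 ∤ ∏c_ℓ(E)` REPLACED by Jetchev, Compos.
Math. 144 (2008) Thm. 1.1 (= arXiv Cor. 1.5; `hJ`, PUBLISHED named fact: Hypothesis (∗) «`p ∤ 2N`, `ρ̄_{E,p}`
onto» — `3 ∤ N` holds on X8 —, `d_K ≠ −3`, `y_K` of infinite order) and its two side conditions: `E`
carries an OPTIMAL parametrisation datum at its conductor (`hopt`, Jetchev's setting: «a fixed optimal
modular parametrization»; per pair READ on Cremona's `X₀(N)`-optimal curve of the class) and ONE bad prime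
`q ∣ N` carries all the 3-divisibility of the Tamagawa numbers, `ord₃ ∏_ℓ c_ℓ(E) ≤ ord₃ c_q(E)` (`htq`;
vacuous if `3 ∤ ∏c`). With STEP L (from `hLA` + JSW 3.3.1 BY NAME, as in §2) Jetchev's bound squeezes to the
Heegner-index IDENTITY over `K` (`X11b.indexIdentityAt_of_lowerBound_of_jetchev`, GLUE seat gen 7); the twist's
rank-zero `3`-part in print shape comes from the unit zone + Wuthrich (`printShape_rankZero_of_zone_of_wuthrich`);
multr1's descent `X11b.bsdp_of_indexIdentityAt` concludes. NOT reached (said plainly): `3 ∣ c_ℓ(E)` at TWO bad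
primes (JSW §7.4.2's `K″` argument). CONDITIONAL on `hLA` and the data; closes nothing.
[cite: Jetchev2008, Hypothesis (*), Thm. 1.4, Cor. 1.5 (arXiv p. 3) = printed Thm. 1.1 (p. 812)]
[cite: JetchevSkinnerWan2017, Thm. 3.3.1, §7.4.1–§7.4.2 (arXiv:1512.06894 pp. 11, 30–31)]
[cite: Wuthrich2014, Prop. 21 (p. 400)] [cite: Miller2011LMS, §1 and Def. 1.1] -/
theorem X8.bsdp_rankOne_of_acLowerLink_of_twistCertificate_of_jetchev
    (hW : Wuthrich2014.sha_dvd_analyticSha)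
    (h331 : JetchevSkinnerWan2017.thm331_anticyclotomicControl_general)
    (hJ : Jetchev2008.cor15_padicValNat_card_primaryComponent_sha_le)
    (hGZK : rank_eq_analyticRank_of_analyticRank_le_one) (hmod : hasEntireLFunction_rat)
    (hmodP : nonempty_modularParametrizationData)
    (W : WeierstrassCurve ℚ) [W.IsElliptic] [W.IsGloballyMinimal] (hX : ClassX8 W 3)
    (hr : W.analyticRank = 1) (hsurj : Surj W 3)
    (N : ℕ) [NeZero N] (hN : W.conductorNorm ℤ = N)
    -- Jetchev's setting: an optimal parametrisation datum; the Tamagawa `3`-divisibility at ONE bad prime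
    (hopt : ∃ Dt : ModularParametrizationData W N,
      ∀ z ∈ Dt.L.lattice, ∃ w ∈ periodLattice Dt.f, z = (Dt.c : ℂ) * w)
    (q : ℕ) [Fact q.Prime] (hqN : q ∣ N)
    (htq : padicValNat 3 W.tamagawaProduct ≤
      padicValNat 3 ((W.baseChange ℚ_[q]).localTamagawaNumber ℤ_[q]))
    (K : Type) [Field K] [NumberField K]
    (hGZ : gross_zagier N W K) (hKo : kolyvagin N W K)
    (hK : IsImaginaryQuadratic K) (hD3 : NumberField.discr K ≠ -3) (hHN : SatisfiesHeegnerHypothesis N K)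
    (hHp : SatisfiesHeegnerHypothesis 3 K)
    (Dt : ModularParametrizationData W N) (H : HeegnerDatum N (NumberField.discr K)) (ιC : K →+* ℂ)
    (P : (W.baseChange K).toAffine.Point)
    (hP : WeierstrassCurve.Affine.Point.map ιC.toRatAlgHom P = heegnerPointComplex Dt H)
    (hc : ¬ ((3 : ℕ) : ℤ) ∣ Dt.c) (hμ : ¬ (3 : ℕ) ∣ Units.torsionOrder K)
    (Wd : WeierstrassCurve ℚ) [Wd.IsElliptic] [Wd.IsGloballyMinimal] (Cd : VariableChange ℚ)
    (hWd : Cd • W.quadraticTwist (NumberField.discr K : ℚ) = Wd)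
    (hLt : (W.quadraticTwist (NumberField.discr K : ℚ)).entireLFunction 1 ≠ 0)
    (hzone : ∃ q : ℚ, Wd.entireLFunction 1 / (Wd.realPeriodRat : ℂ) = (q : ℂ) ∧
      padicValRat 3 q + 2 * padicValNat 3 Wd.torsionOrder ≤ padicValNat 3 Wd.tamagawaProduct)
    (hLA : ∀ (κ : ZpExtension K 3), κ.IsAnticyclotomic →
      ∀ (γ : Field.absoluteGaloisGroup K) [Fact (κ.IsTopGenerator γ)] (𝔭 : HeightOneSpectrum (𝓞 K))
        (h𝔭 : (((3 : ℕ) : ℕ) : 𝓞 K) ∈ 𝔭.asIdeal) (he : 𝔭.asIdeal.ramificationIdx (𝓞 ℚ) = 1)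
        (hf : 𝔭.asIdeal.inertiaDeg (𝓞 ℚ) = 1),
        X11b.IMCLowerWaldspurgerOnTreeGoodAt 3 κ 𝔭 γ (X11b.embAt K 3 𝔭 h𝔭 he hf) P) :
    BSDp W 3 := by
  have hp2 : (3 : ℕ) ≠ 2 := by decide
  haveI hEK : (W.baseChange K).IsElliptic := isElliptic_baseChange' W K
  have hD0 : (NumberField.discr K : ℚ) ≠ 0 := by exact_mod_cast NumberField.discr_ne_zero K
  haveI hEt : (W.quadraticTwist (NumberField.discr K : ℚ)).IsElliptic := W.isElliptic_quadraticTwist hD0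
  have hgood : W.HasGoodReductionAtPrime 3 := hX.2.1.1
  have h3N : ¬ (3 : ℕ) ∣ N := by
    rw [← hN]
    exact fun h ↦ ((W.dvd_conductorNorm_iff_not_hasGoodReductionAtPrime 3).mp h) hgood
  -- transports to the twist at `3`
  have h3d : ¬ ((3 : ℕ) : ℤ) ∣ NumberField.discr K :=
    Literature.SatisfiesHeegnerHypothesis.not_dvd_discr hK.1 hHp Nat.prime_three (dvd_refl 3)
  have hsq : IsSquare (algebraMap ℚ ℚ_[3] (NumberField.discr K : ℚ)) :=
    X11b.isSquare_discr_padic_of_heegner K hK hHp 3 (dvd_refl 3)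
  have hgoodt : (W.quadraticTwist (NumberField.discr K : ℚ)).HasGoodReductionAtPrime 3 :=
    (AdditiveBranchIMCGordTwoRankOne.HeegnerKolyvagin.hasGoodReductionAtPrime_quadraticTwist_iff_of_isSquare
      W hD0 hsq).mpr hgood
  have hgoodd : Wd.HasGoodReductionAtPrime 3 := by
    rw [← hWd]
    exact (AdditiveBranchIMCGordTwoRankOne.HeegnerKolyvagin.hasGoodReductionAtPrime_smul_iff' _ Cd 3).mpr hgoodt
  have hu : padicValRat 3 (Cd.u : ℚ) = 0 :=
    X11b.padicValRat_u_eq_zero_of_twist_good W 3 (by exact_mod_cast h3d) hgood Cd hWd hgoodd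
  have htam : padicValNat 3 Wd.tamagawaProduct = padicValNat 3 W.tamagawaProduct :=
    O5.TwistTamagawa.padicValNat_tamagawaProduct_twist_of_heegner_three W Wd K hK (by rw [hN]; exact hHN)
      (by exact_mod_cast h3d) Cd hWd
  have hsurjd : Surj Wd 3 := X11b.surj_twist_model W 3 K hsurj Cd hWd
  have hLd' : (W.quadraticTwist (NumberField.discr K : ℚ)).entireLFunction = Wd.entireLFunction := by
    rw [← hWd, entireLFunction_smul]
  have hLd1 : Wd.entireLFunction 1 ≠ 0 := by rw [← hLd']; exact hLt
  -- the Heegner point is non-torsion (Gross–Zagier); Kolyvagin: `rank E(K) = 1`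
  have hPH : IsHeegnerPoint N W K P := ⟨Dt, H, ιC, hP⟩
  have hL0 : W.entireLFunction 1 = 0 := entireLFunction_one_eq_zero_of_analyticRank_eq_one hr
  obtain ⟨-, hderiv⟩ := leadingLCoeff_eq_deriv_of_analyticRank_eq_one hr
  have hLK : LDerivEK W K ≠ 0 := by
    rw [lDerivEK_eq_deriv_mul W K hmod hL0]
    exact mul_ne_zero hderiv hLt
  have hPinf : ¬ IsOfFinAddOrder P := (lDerivEK_ne_zero_iff_not_isOfFinAddOrder W N K hGZ hK hHN hPH).mp hLK
  obtain ⟨hrkK, -⟩ := hKo hK hHN hPH hPinf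
  -- STEP L from (CTL) BY NAME + the displayed link, granted finiteness of `Ш(E/K)`
  have hL : Finite (W.baseChange K).sha → X11b.IndexLowerBoundAt W 3 K P := fun hfinK ↦ by
    haveI := hfinK
    have hfinKp : Finite (AddCommGroup.primaryComponent (W.baseChange K).sha 3) :=
      Finite.of_injective _ Subtype.val_injective
    obtain ⟨κ, γ, 𝔭, hκ, hγ, h𝔭⟩ := X11b.exists_anticyclotomic_generator_prime (p := 3) hK
    haveI : Fact (κ.IsTopGenerator γ) := ⟨hγ⟩
    have hsplit : X11b.SplitsIn K 3 := hHp 3 Fact.out (dvd_refl 3)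
    obtain ⟨he, hf⟩ := X11b.degreeOne_of_splitsIn hK.1 hsplit h𝔭
    have hirrK : (W.baseChange K).HasIrreducibleModPGaloisRep 3 :=
      hasIrreducibleModPGaloisRep_baseChange_of_dvd_frobeniusTrace W 3 hp2
        (W.not_dvd_minimalDiscriminantInt_of_hasGoodReductionAtPrime' 3 hX.2.1.1) hX.2.1.2 K hK.1
    have hCTL : X11b.ControlOnTreeGoodAt 3 κ 𝔭 γ (X11b.embAt K 3 𝔭 h𝔭 he hf) P :=
      X11b.controlOnTreeGoodAt_of_thm331_embAt
        (JetchevSkinnerWan2017.thm331_anticyclotomicControl_of_general h331) (le_refl 3) hX.2.1.1 hK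
        hHp hN hHN hirrK κ hκ γ 𝔭 h𝔭 he hf hrkK hfinKp P hPinf
    exact X11b.indexLowerBoundAt_of_onTreeGoodLowerLinks_of_allSplit hK hN hHN (hLA κ hκ γ 𝔭 h𝔭 he hf) hCTL
  -- Jetchev's STEP U squeezes STEP L to the identity over `K`
  have hid : Finite (W.baseChange K).sha → X11b.IndexIdentityAt W 3 K P := fun hfinK ↦ by
    haveI := hfinK
    exact X11b.indexIdentityAt_of_lowerBound_of_jetchev W 3 hJ hK hD3 hHN hopt hPH hPinf hp2 h3N hsurj hqN
      htq (hL hfinK)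
  -- the twist's rank-zero `3`-part in print shape (unit zone + Wuthrich), then multr1's descent
  have htw := printShape_rankZero_of_zone_of_wuthrich hW hGZK hmod hmodP Wd 3 hp2 hLd1 hgoodd hsurjd hzone
  exact X11b.bsdp_of_indexIdentityAt W 3 N K Dt H ιC P hGZ hKo hGZK hmod hK hHN hP hp2 hc hμ hr hLt Wd Cd
    hWd htw htam hu hid

/-! ### The Heegner DATUM discharged: per pair only the FIELD, the twist model and the certificate remain -/

/-- **`BSD(E,3)` at a RANK-ONE X8 pair — the parametrisation datum, the Heegner datum and the Heegner point
DISCHARGED by existence theorems of the tree** (modularity `hnf` + Mazur 1978 Cor. 4.1 `hMaz` + the Néron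
mapping property `hNS` give a datum of level `N_E` with `3 ∤ c` since `9 ∤ N_E`, `E[3]` irreducible:
`X11b.exists_modularParametrizationData_not_dvd`; a Heegner datum and the Heegner point:
`exists_dvd_sq_sub_discr_holds`, `nonempty_heegnerDatum_holds`, `heegnerPointComplex_mem_range_map_holds`;
`#𝓞_K^× = 2` from `d_K < −4`). What remains per pair: the FIELD `K` (imaginary quadratic, `d_K < −4`, every
`ℓ ∣ N_E` and `3` split), a globally minimal model `Wd` of `E^{(d_K)}`, the CERTIFICATE (`L(E^{(d_K)},1) ≠ 0`
and the 3-adic zone of `Wd`), the side conditions `ρ̄_{E,3}` onto and `3 ∤ ∏c(E)`, and the displayed link `hLA`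
— now demanded at EVERY datum of level `N_E` over `K` (the shape of the crux item X8-AC posted to the cell
planner). CONDITIONAL on `hLA`; closes nothing. [cite: Mazur1978, Cor. 4.1]
[cite: JetchevSkinnerWan2017, Thm. 3.3.1, §7.4.1–§7.4.2] [cite: McCallumLMS1991, §1 Theorem (Kolyvagin), p. 296]
[cite: Wuthrich2014, Prop. 21 (p. 400)] [cite: GrossLMS1991, Thm. 1.3, Prop. 2.1] [cite: Miller2011LMS, Def. 1.1] -/
theorem X8.bsdp_rankOne_of_acLowerLinks_of_twistCertificate_field
    (hW : Wuthrich2014.sha_dvd_analyticSha)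
    (h331 : JetchevSkinnerWan2017.thm331_anticyclotomicControl_general)
    (hGZ : ∀ (N : ℕ) [NeZero N] (V : WeierstrassCurve ℚ) (K : Type) [Field K] [NumberField K],
      gross_zagier N V K)
    (hKo : ∀ (N : ℕ) [NeZero N] (V : WeierstrassCurve ℚ) (K : Type) [Field K] [NumberField K],
      kolyvagin N V K)
    (hB : ∀ (N : ℕ) [NeZero N] (V : WeierstrassCurve ℚ) (K : Type) [Field K] [NumberField K],
      Kolyvagin1990_padicValNat_card_sha_le N V K)
    (hGZK : rank_eq_analyticRank_of_analyticRank_le_one) (hmod : hasEntireLFunction_rat)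
    (hmodP : nonempty_modularParametrizationData) (hnf : exists_isNewformOf)
    (hMaz : mazur_not_dvd_maninConstant_of_odd) (hNS : integral_neronScaling_of_isGloballyMinimal)
    (W : WeierstrassCurve ℚ) [W.IsElliptic] [W.IsGloballyMinimal] (hX : ClassX8 W 3)
    (hr : W.analyticRank = 1) (hsurj : Surj W 3) (htam0 : ¬ (3 : ℕ) ∣ W.tamagawaProduct)
    -- the field
    (K : Type) [Field K] [NumberField K] (hK : IsImaginaryQuadratic K) (hdK : NumberField.discr K < -4)
    (hHN : SatisfiesHeegnerHypothesis (W.conductorNorm ℤ) K) (hHp : SatisfiesHeegnerHypothesis 3 K)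
    -- the twist model and the certificate
    (Wd : WeierstrassCurve ℚ) [Wd.IsElliptic] [Wd.IsGloballyMinimal] (Cd : VariableChange ℚ)
    (hWd : Cd • W.quadraticTwist (NumberField.discr K : ℚ) = Wd)
    (hLt : (W.quadraticTwist (NumberField.discr K : ℚ)).entireLFunction 1 ≠ 0)
    (hzone : ∃ q : ℚ, Wd.entireLFunction 1 / (Wd.realPeriodRat : ℂ) = (q : ℂ) ∧
      padicValRat 3 q + 2 * padicValNat 3 Wd.torsionOrder ≤ padicValNat 3 Wd.tamagawaProduct)
    -- the displayed link at EVERY datum of level `N_E` over `K`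
    (hLA : ∀ (N : ℕ) [NeZero N] (Dt : ModularParametrizationData W N) (H : HeegnerDatum N (NumberField.discr K))
      (ιC : K →+* ℂ) (P : (W.baseChange K).toAffine.Point),
      W.conductorNorm ℤ = N → WeierstrassCurve.Affine.Point.map ιC.toRatAlgHom P = heegnerPointComplex Dt H →
      ¬ ((3 : ℕ) : ℤ) ∣ Dt.c → ¬ IsOfFinAddOrder P →
      ∀ (κ : ZpExtension K 3), κ.IsAnticyclotomic →
        ∀ (γ : Field.absoluteGaloisGroup K) [Fact (κ.IsTopGenerator γ)] (𝔭 : HeightOneSpectrum (𝓞 K))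
          (h𝔭 : (((3 : ℕ) : ℕ) : 𝓞 K) ∈ 𝔭.asIdeal) (he : 𝔭.asIdeal.ramificationIdx (𝓞 ℚ) = 1)
          (hf : 𝔭.asIdeal.inertiaDeg (𝓞 ℚ) = 1),
          X11b.IMCLowerWaldspurgerOnTreeGoodAt 3 κ 𝔭 γ (X11b.embAt K 3 𝔭 h𝔭 he hf) P) :
    BSDp W 3 := by
  have hp2 : (3 : ℕ) ≠ 2 := by decide
  haveI : NeZero (W.conductorNorm ℤ) := ⟨(W.conductorNorm_pos_holds).ne'⟩
  have hD0 : (NumberField.discr K : ℚ) ≠ 0 := by exact_mod_cast NumberField.discr_ne_zero K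
  haveI hEt : (W.quadraticTwist (NumberField.discr K : ℚ)).IsElliptic := W.isElliptic_quadraticTwist hD0
  -- `w_K = 2`, prime to `3`
  have hμ : ¬ (3 : ℕ) ∣ Units.torsionOrder K := by
    rw [Literature.NumberTheory.DiophantineGeometry.torsionOrder_eq_two_of_discr_lt hK.1 hdK]; decide
  -- a datum of level `N_E` with `3 ∤ c` (Mazur: `9 ∤ N_E`), a Heegner datum, the Heegner point
  have hgood : W.HasGoodReductionAtPrime 3 := hX.2.1.1
  have h3N : ¬ (3 : ℕ) ∣ W.conductorNorm ℤ :=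
    fun h ↦ ((W.dvd_conductorNorm_iff_not_hasGoodReductionAtPrime 3).mp h) hgood
  have h9N : ¬ 3 ^ 2 ∣ W.conductorNorm ℤ := fun h ↦ h3N (dvd_trans (dvd_pow_self 3 two_ne_zero) h)
  obtain ⟨Dt, hc⟩ := X11b.exists_modularParametrizationData_not_dvd hnf hMaz hNS W rfl Nat.prime_three hp2 h9N
    (ClassX8.irr W 3 hX)
  obtain ⟨β, hβ⟩ := exists_dvd_sq_sub_discr_holds (W.conductorNorm ℤ) K hK hHN
  obtain ⟨H, -⟩ := nonempty_heegnerDatum_holds (W.conductorNorm ℤ) K hK hβ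
  obtain ⟨ιC⟩ : Nonempty (K →+* ℂ) := inferInstance
  obtain ⟨P, hP⟩ := heegnerPointComplex_mem_range_map_holds (W.conductorNorm ℤ) W K hK hHN Dt H ιC
  -- the Heegner point is non-torsion (Gross–Zagier)
  have hPH : IsHeegnerPoint (W.conductorNorm ℤ) W K P := ⟨Dt, H, ιC, hP⟩
  have hL0 : W.entireLFunction 1 = 0 := entireLFunction_one_eq_zero_of_analyticRank_eq_one hr
  obtain ⟨-, hderiv⟩ := leadingLCoeff_eq_deriv_of_analyticRank_eq_one hr
  have hLK : LDerivEK W K ≠ 0 := by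
    rw [lDerivEK_eq_deriv_mul W K hmod hL0]
    exact mul_ne_zero hderiv hLt
  have hPinf : ¬ IsOfFinAddOrder P :=
    (lDerivEK_ne_zero_iff_not_isOfFinAddOrder W (W.conductorNorm ℤ) K (hGZ _ W K) hK hHN hPH).mp hLK
  exact X8.bsdp_rankOne_of_acLowerLink_of_twistCertificate hW h331 hGZK hmod hmodP W hX hr hsurj htam0
    (W.conductorNorm ℤ) rfl K (hGZ _ W K) (hKo _ W K) (hB _ W K) hK hHN hHp Dt H ιC P hP hc hμ Wd Cd hWd hLt
    hzone (hLA (W.conductorNorm ℤ) Dt H ιC P rfl hP hc hPinf)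

end Summit.BirchSwinnertonDyer.BirchSwinnertonDyer.Theorems.X8TwistCertificate

end
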